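import Summits.BirchSwinnertonDyer.BirchSwinnertonDyer.Theorems.GenusKolyvaginAtTwoGenusPrimitiveSupplyAtTwoPrimeTwistSandwich
import Summits.BirchSwinnertonDyer.BirchSwinnertonDyer.Theorems.GenusKolyvaginAtTwoGenusPrimitiveSupplyAtTwoArchimedeanKummerCard
import Literature.NumberTheory.GaloisRepresentations.TateH2VanishingArchimedean
import Literature.NumberTheory.GaloisRepresentations.ContinuousH1OrderTwo
import Literature.NumberTheory.EllipticCurves.PointDivisibilityProofs
import HarnessLib

/-!
# Route `GenusKolyvaginAtTwo`, crux #2 `GenusPrimitiveSupplyAtTwo` (stmt-BirchSwinnertonDyer-22136):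
# THE REAL PLACE of the prime-twist dictionary — `H¹_f(ℝ, E[2]) ∩ H¹_𝒜(ℝ, E[2]) = 0` for `d < 0`, hence `Sel₂(W) ∩ Sel_𝔓(A_χ/ℚ) = Sel₂^{str ∞}(W)`
# and, on the egg stratum, `Sel_𝔓(A_χ/ℚ) = ker(loc_∞ | Sel₂(W))` EXACTLY

Width seat `bsd-line-gk2-p5` g14 (cell `bsd-f1-sign2`, SUPPLY lineage of crux 22136), file 35 of the series; sequel of file 34 (`…PrimeTwistSandwich`).
THEOREMS ONLY (no definition, no named fact, no `sorry`); helper `--supports stmt-BirchSwinnertonDyer-22136`; no item is closed; BSD is not proved.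

WHAT (Kramer 1981 Prop. 7 / Mazur–Rubin 2007 Prop. 5.2 at the REAL place, `p = 2`, in prime-twist currency). `F` a field over the number field `K`
whose absolute Galois group has order `≤ 2` (the completions at the infinite places: tree `natCard_absoluteGaloisGroup_completion_infinitePlace_le_two`),
`d ∈ K` NOT a square in `F` (so `Γ_F = {1, τ₀}` with `τ₀ (ι√d) = −ι√d`), `χ|_{Γ_F}` the character of `F(ι√d)`:
* §150 `exists_flip_closureEmb_geomSqrt_field` — the flip `τ₀` over any `K`-field `F` with `d ∉ F²` (file 38's `exists_flip_closureEmb_geomSqrt` verbatim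
  for a general `F`).
* §151 **`res_eq_zero_of_mem_selmerLocalKer_of_mem_primeTwist_selmerLocalKer`** — a class of `H¹(K, E[2])` lying in BOTH `E`'s Kummer condition and
  `A_χ`'s `𝔓`-Selmer condition at `F` restricts to ZERO in `H¹(F, E[2])`: if `c|_{Γ_F} = ∂Q = ∂^χ(R, −R)` then `τ₀(Q + R) = Q − R`; halving
  `Q + R = 2A'` in `E(F̄)` (`zsmul_surjective_of_isAlgClosed`) the norm `N = A' + τ₀A'` is `Γ_F`-fixed with `2N = 2Q`, so `T = Q − N ∈ E[2]` and
  `c|_{Γ_F} = ∂T` (Kramer: `H¹_f ∩ H¹_f^χ = δ(N E(F(√d)))`, and `N E(ℂ) = 2E(ℝ)`).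
* §152 over `ℚ` (every infinite place real, `d < 0` for descent-admissible `d`): **`selmerGroup_inf_primeTwist_selmerGroup_eq_kummerStrict`** —
  `Sel₂(W) ⊓ Sel_𝔓(A_χ/ℚ) = Sel₂^{str ∞}(W)`; **`primeTwist_selmerGroup_eq_selmerGroup_kummerStrict_of_meetsEgg`** — on the egg stratum
  `Sel_𝔓(A_χ/ℚ) = Sel₂^{str ∞}(W) = {c ∈ Sel₂(W) | loc_∞ c = 0}` (the -desc §27 «`Ш[2]` in the door» identification `Sel₂(W^d) = ker(loc_∞ | Sel₂(W))`
  in prime-twist currency, unconditional).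

Honest framing: KNOWN in print (Kramer 1981 Prop. 6–7; MR 2007 Prop. 5.2; MR 2010 Lemma 3.2); kernel-new; beyond-print theorem: no. Crux 22136 stays OPEN
exactly at (U) 24947 ∧ (CONV₂) 19220/24948. BSD is not proved by any of this.

References: [Kramer1981] Prop. 6, Prop. 7; [MazurRubin2007] Prop. 5.2, Def 4.3; [MazurRubin2010] Def. 3.1, Lemma 3.2.
-/

set_option linter.dupNamespace false -- tree convention: `Summit.BirchSwinnertonDyer.BirchSwinnertonDyer.Theorems` (summit = sub-problem)
set_option autoImplicit false

noncomputable section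

open scoped Classical

namespace Summit.BirchSwinnertonDyer.BirchSwinnertonDyer.Theorems.GenusKolyArch

open WeierstrassCurve Field NumberField IsDedekindDomain Function Polynomial
open Literature.NumberTheory.EllipticCurves Literature.NumberTheory.GaloisRepresentations
open Literature.NumberTheory.GaloisCohomology
open Literature.NumberTheory.EllipticCurves.PrimeTwist (ResPoints points localChar localModule locMap constEmb mem_points_iff
  coe_locMap_constEmb_apply)
open Summit.BirchSwinnertonDyer.Rank1Residual.X11b.KummerPT (kummerStrict kummerRelaxed)
open Summit.BirchSwinnertonDyer.Rank1Residual.F1Sign2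

/-! ## §150 The flip over a general `K`-field -/

section Flip

variable {K : Type} [Field K] {d : K} (F : Type) [Field F] [Algebra K F]

/-- `(ι√d)² = d` in `F̄`. [folklore] -/
theorem closureEmb_geomSqrt_sq_eq_algebraMap_field :
    closureEmb (K := K) F (geomSqrt d) ^ 2 = algebraMap F (AlgebraicClosure F) (algebraMap K F d) := by
  rw [← map_pow, geomSqrt_sq, AlgHom.commutes, ← IsScalarTower.algebraMap_apply]

/-- `[F(ι√d) : F] = 2` when `d ∉ F²`. [folklore] -/
theorem finrank_adjoin_closureEmb_geomSqrt_eq_two_field (hd : ∀ s : F, s ^ 2 ≠ algebraMap K F d) :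
    Module.finrank F (IntermediateField.adjoin F {closureEmb (K := K) F (geomSqrt d)}) = 2 := by
  have hirr : Irreducible (X ^ 2 - C (algebraMap K F d) : F[X]) := X_pow_sub_C_irreducible_of_prime Nat.prime_two hd
  have hint := isIntegral_closureEmb_geomSqrt (K := K) (d := d) F
  have hmin : minpoly F (closureEmb (K := K) F (geomSqrt d)) = X ^ 2 - C (algebraMap K F d) := by
    refine (minpoly.eq_of_irreducible_of_monic hirr ?_ (monic_X_pow_sub_C _ two_ne_zero)).symm
    simp [closureEmb_geomSqrt_sq_eq_algebraMap_field F]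
  rw [IntermediateField.adjoin.finrank hint, hmin, natDegree_X_pow_sub_C]

/-- The generator of `F(ι√d)` squares to `d`. [folklore] -/
theorem adjoinSimple_gen_sq_field :
    (IntermediateField.AdjoinSimple.gen F (closureEmb (K := K) F (geomSqrt d))) ^ 2 =
      algebraMap F _ (algebraMap K F d) := by
  apply Subtype.ext
  rw [SubmonoidClass.coe_pow, IntermediateField.AdjoinSimple.coe_gen, closureEmb_geomSqrt_sq_eq_algebraMap_field F]
  rfl

/-- The generator of `F(ι√d)` is not in `F` when `d ∉ F²`. [folklore] -/
theorem adjoinSimple_gen_not_mem_range_field (hd : ∀ s : F, s ^ 2 ≠ algebraMap K F d) :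
    IntermediateField.AdjoinSimple.gen F (closureEmb (K := K) F (geomSqrt d)) ∉
      Set.range (algebraMap F (IntermediateField.adjoin F {closureEmb (K := K) F (geomSqrt d)})) := by
  rintro ⟨a, ha⟩
  apply hd a
  have h : algebraMap F (AlgebraicClosure F) a = closureEmb (K := K) F (geomSqrt d) := by
    rw [← IntermediateField.AdjoinSimple.coe_gen F (closureEmb (K := K) F (geomSqrt d)), ← ha]
    rfl
  apply (algebraMap F (AlgebraicClosure F)).injective
  rw [map_pow, h, closureEmb_geomSqrt_sq_eq_algebraMap_field F]

/-- **Some `τ₀ ∈ Γ_F` flips `ι√d`** when `d ∉ F²`, for ANY `K`-field `F` (file 38's `exists_flip_closureEmb_geomSqrt` verbatim). [folklore] -/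
theorem exists_flip_closureEmb_geomSqrt_field (hd : ∀ s : F, s ^ 2 ≠ algebraMap K F d) :
    ∃ τ₀ : absoluteGaloisGroup F,
      (show AlgebraicClosure F ≃ₐ[F] AlgebraicClosure F from τ₀) (closureEmb (K := K) F (geomSqrt d)) =
        -closureEmb (K := K) F (geomSqrt d) := by
  have hint := isIntegral_closureEmb_geomSqrt (K := K) (d := d) F
  haveI : FiniteDimensional F (IntermediateField.adjoin F {closureEmb (K := K) F (geomSqrt d)}) :=
    IntermediateField.adjoin.finiteDimensional hint
  obtain ⟨τ₀, hτ₀⟩ := exists_smul_geomSqrt_eq_neg (finrank_adjoin_closureEmb_geomSqrt_eq_two_field F hd)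
    (adjoinSimple_gen_not_mem_range_field F hd) (adjoinSimple_gen_sq_field F)
  refine ⟨τ₀, ?_⟩
  have hsq : closureEmb (K := K) F (geomSqrt d) ^ 2 = geomSqrt (algebraMap K F d) ^ 2 := by
    rw [closureEmb_geomSqrt_sq_eq_algebraMap_field F, geomSqrt_sq]
  change τ₀ • closureEmb (K := K) F (geomSqrt d) = _
  rcases sq_eq_sq_iff_eq_or_eq_neg.mp hsq with h | h
  · rw [h, hτ₀]
  · rw [h, smul_neg, hτ₀, neg_neg]

end Flip

/-! ## §151 The real-place lemma: `H¹_f(F) ∩ H¹_𝒜(F)` restricts to `0` when `#Γ_F ≤ 2` and `d ∉ F²` -/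

section OrderTwo

variable {K : Type} [Field K] [NumberField K] (W : WeierstrassCurve K) [W.IsElliptic] {d : K}
variable (χ : absoluteGaloisGroup K →ₜ* Multiplicative (ZMod 2)) (F : Type) [Field F] [Algebra K F]

/-- **`H¹_f(F, E[2]) ∩ H¹_𝒜(F, E[2]) = 0` for `Γ_F` of order `≤ 2` and `d ∉ F²`** (the archimedean case of Kramer's Prop. 7 /
Mazur–Rubin's `H¹_f ∩ H¹_f^χ = δ(N E(F(√d)))` with `N E(F̄) ⊆ 2 E(F)`): a class of `H¹(K, E[2])` in `E`'s Kummer condition AND in `A_χ`'s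
`𝔓`-Selmer condition at `F` restricts to zero in `H¹(F, E[2])`. [cite: Kramer1981, Prop. 6 and Prop. 7] [cite: MazurRubin2007, Prop. 5.2] -/
theorem res_eq_zero_of_mem_selmerLocalKer_of_mem_primeTwist_selmerLocalKer [Finite (absoluteGaloisGroup F)]
    (hΓ : Nat.card (absoluteGaloisGroup F) ≤ 2) (hd : ∀ s : F, s ^ 2 ≠ algebraMap K F d)
    (hχα : ∀ τ : absoluteGaloisGroup F, χ (resGal (K := K) F τ) = 1 ↔
      (show AlgebraicClosure F ≃ₐ[F] AlgebraicClosure F from τ) (closureEmb (K := K) F (geomSqrt d)) = closureEmb (K := K) F (geomSqrt d))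
    {c : W.galH1Torsion ((2 : ℕ) : ℤ)} (hW : c ∈ W.selmerLocalKer F 2) (hA : c ∈ PrimeTwist.selmerLocalKer W χ F) :
    galoisCohomology.res (W.torsionGaloisModule ((2 : ℕ) : ℤ)) F 1 c = 0 := by
  haveI : CharZero F := charZero_of_injective_algebraMap (algebraMap K F).injective
  set α := closureEmb (K := K) F (geomSqrt d) with hαdef
  obtain ⟨τ₀, hτ₀⟩ := exists_flip_closureEmb_geomSqrt_field F hd
  have hα0 : α ≠ 0 := by
    intro h0
    apply hd 0
    have h' := closureEmb_geomSqrt_sq_eq_algebraMap_field (K := K) (d := d) F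
    rw [← hαdef, h0, zero_pow two_ne_zero, eq_comm, map_eq_zero] at h'
    rw [h', zero_pow two_ne_zero]
  have hne : (show AlgebraicClosure F ≃ₐ[F] AlgebraicClosure F from τ₀) α ≠ α := by
    intro h
    rw [h] at hτ₀
    have h2 : α + α = 0 := by nth_rw 2 [hτ₀]; exact add_neg_cancel α
    rw [← two_mul, mul_eq_zero, or_iff_right (two_ne_zero)] at h2
    exact hα0 h2
  have hτ₀1 : τ₀ ≠ 1 := by
    intro h
    apply hne
    rw [h]
    rfl
  have hsq : τ₀ * τ₀ = 1 := mul_self_eq_one_of_natCard_le_two hΓ τ₀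
  have hall : ∀ τ : absoluteGaloisGroup F, τ = 1 ∨ τ = τ₀ := fun τ ↦ by
    by_cases h : τ = 1
    · exact Or.inl h
    · exact Or.inr (eq_of_ne_one_of_natCard_le_two hΓ h hτ₀1)
  -- the two bounding cochains
  obtain ⟨φ, rfl⟩ := oneCocycleClass_surjective
    (discreteTopRep (absoluteGaloisGroup K) (W.geomTorsion ((2 : ℕ) : ℤ))) c
  obtain ⟨Q, hQ⟩ := (oneCocycleClass_mem_resKer_iff _ _ _ φ).mp hW
  obtain ⟨f, hf⟩ := (oneCocycleClass_mem_resKer_iff _ _ _ φ).mp hA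
  set cτ : absoluteGaloisGroup F → localPoints W F :=
    fun τ ↦ pointsMap W F ((φ.1 (resGal (K := K) F τ) : W.geomTorsion ((2 : ℕ) : ℤ)) : W.geomPoints) with hcτ
  have hcQ : ∀ τ, cτ τ = τ • Q - Q := fun τ ↦ by
    rw [← hQ τ, AddMonoidHom.comp_apply, AddSubgroup.coe_subtype]
  set R : localPoints W F := (f : ResPoints (localChar χ F) (localPoints W F)) 0 with hRdef
  have hR1 : (f : ResPoints (localChar χ F) (localPoints W F)) 1 = -R := by
    have h := (mem_points_iff (localChar χ F) (localPoints W F) _).mp f.2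
    change ∑ i : Fin 2, (f : ResPoints (localChar χ F) (localPoints W F)) i = 0 at h
    rw [Fin.sum_univ_two] at h
    exact eq_neg_of_add_eq_zero_right h
  have hcoord : cτ τ₀ = τ₀ • (f : ResPoints (localChar χ F) (localPoints W F)) (0 - ResPoints.expo (localChar χ F) τ₀) - R := by
    have h := congrArg (fun g : localModule W χ F ↦ (g : ResPoints (localChar χ F) (localPoints W F)) 0) (hf τ₀)
    simp only at h
    rw [coe_locMap_constEmb_apply, AddSubgroupClass.coe_sub, PrimeTwist.ResPoints.sub_apply, PrimeTwist.points.coe_smul,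
      PrimeTwist.ResPoints.smul_apply'] at h
    exact h
  have hflipR : cτ τ₀ = -(τ₀ • R) - R := by
    rw [hcoord, (expo_localChar_eq_of_iff χ hχα τ₀).2 hne, show (0 : ZMod 2) - 1 = 1 by decide, hR1, smul_neg]
  -- the norm trick: `τ₀ (Q + R) = Q − R`, `Q + R = 2A'`, `N = A' + τ₀A'` is `Γ_F`-fixed, `2N = 2Q`
  have hτ₀Q : τ₀ • Q = Q + cτ τ₀ := by rw [hcQ]; abel
  have hτ₀R : τ₀ • R = -R - cτ τ₀ := by rw [hflipR]; abel
  have hτ₀A : τ₀ • (Q + R) = Q - R := by rw [smul_add, hτ₀Q, hτ₀R]; abel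
  obtain ⟨A', hA'⟩ : ∃ A' : localPoints W F, (2 : ℤ) • A' = Q + R :=
    (W.baseChange (AlgebraicClosure F)).zsmul_surjective_of_isAlgClosed two_ne_zero (Q + R)
  rw [two_zsmul] at hA'
  set N : localPoints W F := A' + τ₀ • A' with hNdef
  have hNfix : ∀ τ : absoluteGaloisGroup F, τ • N = N := by
    intro τ
    rcases hall τ with rfl | rfl
    · exact one_smul _ _
    · rw [hNdef, smul_add, ← mul_smul, hsq, one_smul, add_comm]
  have hNN : N + N = Q + Q := by
    have h : τ₀ • (A' + A') = Q - R := by rw [hA', hτ₀A]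
    rw [smul_add] at h
    calc N + N = (A' + A') + (τ₀ • A' + τ₀ • A') := by rw [hNdef]; abel
      _ = (Q + R) + (Q - R) := by rw [hA', h]
      _ = Q + Q := by abel
  -- `T = Q − N ∈ E[2]` bounds `c|_{Γ_F}` inside `E[2]`
  set T : localPoints W F := Q - N with hTdef
  have hT2 : ((2 : ℕ) : ℤ) • T = 0 := by
    rw [Nat.cast_ofNat, two_zsmul, hTdef]
    calc Q - N + (Q - N) = (Q + Q) - (N + N) := by abel
      _ = 0 := by rw [hNN, sub_self]
  have hn : ((2 : ℕ) : ℤ) ≠ 0 := by norm_num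
  have hTmem : T ∈ AddSubgroup.torsionBy (localPoints W F) ((2 : ℕ) : ℤ) := by
    change ((2 : ℕ) : ℤ) • T = 0
    exact hT2
  set T₀ : W.geomTorsion ((2 : ℕ) : ℤ) := (W.torsionPointsEquiv ((2 : ℕ) : ℤ) (E := F) hn).symm ⟨T, hTmem⟩ with hT₀def
  have hT₀ : (W.torsionPointsEquiv ((2 : ℕ) : ℤ) (E := F) hn) T₀ = ⟨T, hTmem⟩ := by
    rw [hT₀def, AddEquiv.apply_symm_apply]
  have key : ∀ g : absoluteGaloisGroup F, φ.1 (resGal (K := K) F g) = resGal (K := K) F g • T₀ - T₀ := by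
    intro g
    apply (W.torsionPointsEquiv ((2 : ℕ) : ℤ) (E := F) hn).injective
    rw [map_sub, torsionPointsEquiv_smul, hT₀]
    apply Subtype.ext
    rw [coe_torsionPointsEquiv_apply, AddSubgroupClass.coe_sub, AddSubgroup.torsionBy.coe_smul]
    change cτ g = g • T - T
    rw [hcQ g, hTdef, smul_sub, hNfix g]
    abel
  rw [WeierstrassCurve.res_torsionGaloisModule_oneCocycleClass]
  refine (oneCocycleClass_eq_zero_iff _ _).mpr ⟨T₀, fun g ↦ ?_⟩
  exact key g

/-- Membership corollary: such a class lies in the kernel of `res_F`, i.e. in EVERY restriction-kernel local condition at `F`; in particular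
(`#Γ_F ≤ 2`, `d ∉ F²`) `H¹_f(F) ⊓ H¹_𝒜(F) ≤ ker res_F`. [cite: Kramer1981, Prop. 7] [cite: MazurRubin2007, Prop. 5.2] -/
theorem selmerLocalKer_inf_primeTwist_selmerLocalKer_le_ker_res [Finite (absoluteGaloisGroup F)]
    (hΓ : Nat.card (absoluteGaloisGroup F) ≤ 2) (hd : ∀ s : F, s ^ 2 ≠ algebraMap K F d)
    (hχα : ∀ τ : absoluteGaloisGroup F, χ (resGal (K := K) F τ) = 1 ↔
      (show AlgebraicClosure F ≃ₐ[F] AlgebraicClosure F from τ) (closureEmb (K := K) F (geomSqrt d)) = closureEmb (K := K) F (geomSqrt d)) :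
    W.selmerLocalKer F 2 ⊓ PrimeTwist.selmerLocalKer W χ F ≤ (galoisCohomology.res (W.torsionGaloisModule ((2 : ℕ) : ℤ)) F 1).ker :=
  fun _ hc ↦ AddMonoidHom.mem_ker.mpr
    (res_eq_zero_of_mem_selmerLocalKer_of_mem_primeTwist_selmerLocalKer W χ F hΓ hd hχα hc.1 hc.2)

end OrderTwo

/-! ## §152 Over `ℚ`: `Sel₂(W) ∩ Sel_𝔓(A_χ) = Sel₂^{str ∞}(W)`, and the egg-stratum identification -/

section Rat

variable (W : WeierstrassCurve ℚ) [W.IsElliptic] [W.IsGloballyMinimal] {d : ℤ} {χ : absoluteGaloisGroup ℚ →ₜ* Multiplicative (ZMod 2)}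

omit [W.IsElliptic] [W.IsGloballyMinimal] in
/-- A negative integer is not a square in `ℚ_∞ = ℝ`. [folklore] -/
theorem forall_sq_ne_algebraMap_completion_of_neg (w : InfinitePlace ℚ) (hd : d < 0) :
    ∀ s : w.Completion, s ^ 2 ≠ algebraMap ℚ w.Completion (d : ℚ) := by
  intro s hs
  have hw : w.IsReal := by rw [Subsingleton.elim w Rat.infinitePlace]; exact Rat.isReal_infinitePlace
  have h := congrArg (InfinitePlace.Completion.ringEquivRealOfIsReal hw) hs
  rw [map_pow, ringEquivRealOfIsReal_algebraMap hw, embedding_of_isReal_rat_apply, Rat.cast_intCast] at h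
  have h0 : (0 : ℝ) ≤ (d : ℝ) := h ▸ sq_nonneg _
  have h1 : ((d : ℤ) : ℝ) < 0 := by exact_mod_cast hd
  exact absurd h0 (not_le.mpr h1)

/-- **At the real place of `ℚ`, for a descent-admissible `d` (so `d < 0`): a class in `W`'s Kummer condition and in `A_χ`'s `𝔓`-Selmer condition
at `ℝ` has `loc_∞ c = 0`.** [cite: Kramer1981, Prop. 6 and Prop. 7] [cite: MazurRubin2007, Prop. 5.2] -/
theorem localization_inl_eq_zero_of_mem_of_mem (hd : DescAdmissible W d) (hχ : IsQuadraticCharacterOf χ d) (w : InfinitePlace ℚ)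
    {c : W.galH1Torsion ((2 : ℕ) : ℤ)} (hW : c ∈ W.selmerLocalKer w.Completion 2) (hA : c ∈ PrimeTwist.selmerLocalKer W χ w.Completion) :
    galoisCohomology.localization (W.torsionGaloisModule ((2 : ℕ) : ℤ)) (Sum.inl w) 1 c = 0 := by
  haveI := finite_absoluteGaloisGroup_completion_infinitePlace w
  exact res_eq_zero_of_mem_selmerLocalKer_of_mem_primeTwist_selmerLocalKer W χ w.Completion
    (natCard_absoluteGaloisGroup_completion_infinitePlace_le_two w) (forall_sq_ne_algebraMap_completion_of_neg w hd.1)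
    (localChar_eq_one_iff_of_isQuadraticCharacterOf hχ) hW hA

/-- **`Sel₂(W) ⊓ Sel_𝔓(A_χ/ℚ) = Sel₂^{str ∞}(W)`** inside `H¹(ℚ, E[2])` for every descent-admissible `d` and its character (Mazur–Rubin's
`Sel ∩ Sel^χ = Sel_{strict at T}`, `T = {∞}`): `≥` is file 34's sandwich; `≤` is §151 at the real place.
[cite: MazurRubin2010, Lemma 3.2] [cite: MazurRubin2007, Prop. 5.2] [cite: Kramer1981, Prop. 7] -/
theorem selmerGroup_inf_primeTwist_selmerGroup_eq_kummerStrict (hd : DescAdmissible W d) (hχ : IsQuadraticCharacterOf χ d)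
    (w : InfinitePlace ℚ) :
    W.selmerGroup ((2 : ℕ) : ℤ) ⊓ PrimeTwist.selmerGroup W χ = (kummerStrict W 2 {(Sum.inl w : Place ℚ)}).selmerGroup := by
  refine le_antisymm (fun c hc ↦ ?_) (le_inf (selmerGroup_kummerStrict_singleton_inl_le_selmerGroup W w)
    (selmerGroup_kummerStrict_le_primeTwist_selmerGroup W hd hχ w))
  obtain ⟨hS, hP⟩ := AddSubgroup.mem_inf.mp hc
  have hS' : c ∈ selmerGroupRelaxedAtInfinityAtTwo W ⊓ ⨅ w : InfinitePlace ℚ, W.selmerLocalKer w.Completion ((2 : ℕ) : ℤ) := by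
    rw [selmerGroupRelaxedAtInfinityAtTwo_inf_infinitePlaces]
    exact hS
  obtain ⟨hR, hinf⟩ := AddSubgroup.mem_inf.mp hS'
  have hW : c ∈ W.selmerLocalKer w.Completion ((2 : ℕ) : ℤ) := (AddSubgroup.mem_iInf.mp hinf) w
  have hA : c ∈ PrimeTwist.selmerLocalKer W χ w.Completion := ((PrimeTwist.mem_selmerGroup_iff W χ c).mp hP).2 w
  exact (mem_selmerGroup_kummerStrict_singleton_inl_iff W w c).mpr ⟨hR, localization_inl_eq_zero_of_mem_of_mem W hd hχ w hW hA⟩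

/-- **ON THE EGG STRATUM `Sel_𝔓(A_χ/ℚ) = Sel₂^{str ∞}(W)`** (`Δ_W > 0`, `W` meets the egg, every descent-admissible `d`): the prime-twist Selmer
group IS the `2`-Selmer group of `W` made strict at `∞` — the -desc §27 identification `Sel₂(W^{(d)}) = ker(loc_∞ | Sel₂(W))` in prime-twist currency,
unconditional. [cite: MazurRubin2010, Lemma 3.2 and Prop. 3.3] [cite: Kramer1981, Prop. 7 and Thm. 1] -/
theorem primeTwist_selmerGroup_eq_selmerGroup_kummerStrict_of_meetsEgg (hegg : MeetsEgg W) (hd : DescAdmissible W d)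
    (hχ : IsQuadraticCharacterOf χ d) (w : InfinitePlace ℚ) :
    PrimeTwist.selmerGroup W χ = (kummerStrict W 2 {(Sum.inl w : Place ℚ)}).selmerGroup := by
  refine le_antisymm ?_ (selmerGroup_kummerStrict_le_primeTwist_selmerGroup W hd hχ w)
  rw [← selmerGroup_inf_primeTwist_selmerGroup_eq_kummerStrict W hd hχ w]
  exact le_inf (primeTwist_selmerGroup_le_selmerGroup_of_meetsEgg W hegg hd hχ) le_rfl

/-- Membership form on the egg stratum: **`c ∈ Sel_𝔓(A_χ/ℚ) ↔ c ∈ Sel₂(W) ∧ loc_∞ c = 0`**. [cite: MazurRubin2010, Lemma 3.2 and Prop. 3.3] -/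
theorem mem_primeTwist_selmerGroup_iff_of_meetsEgg (hegg : MeetsEgg W) (hd : DescAdmissible W d) (hχ : IsQuadraticCharacterOf χ d)
    (w : InfinitePlace ℚ) (c : W.galH1Torsion ((2 : ℕ) : ℤ)) :
    c ∈ PrimeTwist.selmerGroup W χ ↔
      c ∈ W.selmerGroup ((2 : ℕ) : ℤ) ∧ galoisCohomology.localization (W.torsionGaloisModule ((2 : ℕ) : ℤ)) (Sum.inl w) 1 c = 0 := by
  rw [primeTwist_selmerGroup_eq_selmerGroup_kummerStrict_of_meetsEgg W hegg hd hχ w]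
  exact mem_selmerGroup_kummerStrict_iff_of_relaxed_eq W (selmerGroupRelaxedAtInfinityAtTwo_eq_selmerGroup_of_meetsEgg W hegg) w c

/-- **The general position of `Sel_𝔓(A_χ/ℚ)`**: for every descent-admissible `d`, `Sel_𝔓(A_χ/ℚ) ⊓ Sel₂(W) = Sel₂^{str ∞}(W)` and
`Sel_𝔓(A_χ/ℚ) ≤ Sel₂^{rel ∞}(W)` — so `Sel_𝔓(A_χ)` is `Sel₂^{str ∞}(W)` itself or a complement of `Sel₂(W)` over `Sel₂^{str ∞}(W)` inside
`Sel₂^{rel ∞}(W)` (the latter exactly when `#Sel_𝔓(A_χ) = 2·#Sel₂^{str ∞}(W)`, e.g. off the egg stratum for `Δ_W > 0` by Kramer's parity).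
[cite: MazurRubin2010, Lemma 3.2 and Prop. 3.3] [cite: Kramer1981, Thm. 1] -/
theorem primeTwist_selmerGroup_position (hd : DescAdmissible W d) (hχ : IsQuadraticCharacterOf χ d) (w : InfinitePlace ℚ) :
    PrimeTwist.selmerGroup W χ ⊓ W.selmerGroup ((2 : ℕ) : ℤ) = (kummerStrict W 2 {(Sum.inl w : Place ℚ)}).selmerGroup ∧
      PrimeTwist.selmerGroup W χ ≤ selmerGroupRelaxedAtInfinityAtTwo W := by
  rw [inf_comm]
  exact ⟨selmerGroup_inf_primeTwist_selmerGroup_eq_kummerStrict W hd hχ w, primeTwist_selmerGroup_le_selmerGroupRelaxedAtInfinityAtTwo W hd hχ⟩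

end Rat

end Summit.BirchSwinnertonDyer.BirchSwinnertonDyer.Theorems.GenusKolyArch

end
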